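import Literature.Probability.RandomPlanarGeometry.LoewnerDerivRatio
import Literature.Probability.RandomPlanarGeometry.LoewnerInverse
import HarnessLib

/-!
# The centred Loewner flow `zₜ = gₜ(z) - Wₜ`, its slope `wₜ = xₜ/yₜ`, and the exit of `|w|` from `[0, s)`

Trunk T-STOCH; layer 4a (deterministic) of the decomposition of the space-filling phase of SLE_κ
(`Literature.Probability.RandomPlanarGeometry.ae_isSpaceFilling_sleTrace_of_eight_le`; Rohde–Schramm, Ann. Math. 161 (2005),
Cor. 7.4 + Update, p. 911), more precisely of its remaining stochastic input, **Lemma 6.3 for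
`κ ≥ 8`** (`Literature.Probability.RandomPlanarGeometry.tendsto_sleDerivRatio_atTop_of_eight_le`: a.s. `Z(z) = lim_{t↑τ(z)} ψₜ = ∞`,
`ψₜ = (Im z) |gₜ'(z)| / Im gₜ(z)`). The printed proof (pp. 904–905) runs the optional sampling
theorem on the local martingale `Mₜ = ψₜ^a Ĝ(zₜ)` at the times
`T = inf{t : |wₜ| = s}`, `wₜ = xₜ/yₜ`, `zₜ = xₜ + i yₜ = gₜ(ẑ) - Wₜ`. This file provides the
deterministic (pathwise, every continuous driving function `W`) part of that argument:

* `Literature.Loewner.centredMap W t z = gₜ(z) - Wₜ` (Rohde–Schramm's `zₜ`), `Literature.Loewner.cotArg W z t =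
  xₜ / yₜ` (their `wₜ`, the cotangent of `arg zₜ`), `Literature.Loewner.derivRatio W z t =
  (Im z) |gₜ'(z)| / Im gₜ(z)` (their `ψₜ`; `Literature.Probability.RandomPlanarGeometry.sleDerivRatio` is its SLE instance), and
  `Literature.Loewner.cotArgExitTime W z s = inf{t < T_z : s ≤ |wₜ|} ∈ [0, ∞]` (their `T`, resp. `T_m`);
* continuity of `t ↦ zₜ, wₜ` on `[0, T_z)`; the first-exit API (`|wₜ| < s` before the exit time,
  the exit time is attained, `|w_T| = s` when `|w₀| < s`);
* **at a finite swallowing time `yₜ → 0`** (`exists_forall_im_centredMap_lt`: the maximal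
  solution approaches the driving function, `IsSolution.exists_norm_sub_lt`, and `yₜ` decreases);
* **if `|wₜ| ≤ s` for all `t < T_z` then `ψₜ → ∞` as `t ↑ T_z`**
  (`tendsto_derivRatio_atTop_of_abs_cotArg_le`), by (6.3) `log ψₜ = ∫₀ᵗ 4y²/|z|⁴` and the two
  bounds `4y²/|z|⁴ ≥ 4/(ŷ²(1+s²)²)` (case `T_z = ∞`) and
  `∫₀ᵗ 4y²/|z|⁴ ≥ (2/(1+s²)) (log ŷ - log yₜ)` ((3.4); case `T_z < ∞`, where `yₜ → 0`). This is
  the observation "if `|Re gₜ(i)/Im gₜ(i)|` never hits `|w₀|`, then we have `Z(i) = ∞`, by (6.3)"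
  (p. 905) made quantitative.

## References

* S. Rohde, O. Schramm, *Basic properties of SLE*, Ann. of Math. 161 (2005) 883–924: Lemma 6.3
  and its proof, eqs. (3.4), (6.3), (6.4) (pp. 890, 903–905).
-/

noncomputable section

open Set Filter Topology Metric MeasureTheory
open UpperHalfPlane (upperHalfPlaneSet isOpen_upperHalfPlaneSet)
open scoped NNReal

namespace Literature.Probability.RandomPlanarGeometry

namespace Loewner

variable {W : ℝ≥0 → ℝ} {z : ℂ} {g : ℝ → ℂ} {T : WithTop ℝ≥0}

/-! ### The centred flow `zₜ`, the slope `wₜ = xₜ/yₜ` and the ratio `ψₜ` -/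

/-- **The centred Loewner map** `zₜ := gₜ(z) - Wₜ` (Rohde–Schramm (2005), proof of Lemma 6.3:
"Let `zₜ = xₜ + i yₜ := gₜ(ẑ) - ξ(t)`", p. 904); meaningful for `t < T_z` (junk `z - Wₜ` after the
swallowing time, from the junk value of `map`). [cite: RohdeSchramm2005, Lemma 6.3] -/
def centredMap (W : ℝ≥0 → ℝ) (t : ℝ≥0) (z : ℂ) : ℂ :=
  map W t z - W t

/-- **The slope `wₜ := xₜ / yₜ`** of the centred flow `zₜ = xₜ + i yₜ` (the cotangent of
`arg zₜ`; Rohde–Schramm (2005), proof of Lemma 6.3: "`w(u) = wₜ := xₜ/yₜ` is a time-homogeneous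
diffusion as a function of `u = log yₜ`", p. 904). Junk (`x/0 = 0` or the junk of `map`) when
`yₜ = 0` or `t ≥ T_z`. [cite: RohdeSchramm2005, Lemma 6.3] -/
def cotArg (W : ℝ≥0 → ℝ) (z : ℂ) (t : ℝ≥0) : ℝ :=
  (centredMap W t z).re / (centredMap W t z).im

/-- **Rohde–Schramm's ratio `ψₜ := (Im z) |gₜ'(z)| / Im gₜ(z)`** whose limit as `t ↑ T_z` is `Z(z)`
(Lemma 6.3, p. 903); `Literature.sleDerivRatio κ ω` is `derivRatio (sleDriving κ ω)`. Junk after `T_z`.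
[cite: RohdeSchramm2005, Lemma 6.3] -/
def derivRatio (W : ℝ≥0 → ℝ) (z : ℂ) (t : ℝ≥0) : ℝ :=
  z.im * ‖deriv (map W t) z‖ / (map W t z).im

/-- **The exit time of `|w|` from `[0, s)`**: `cotArgExitTime W z s = inf{t < T_z : s ≤ |wₜ|}`,
valued in `WithTop ℝ≥0` (`⊤` if `|wₜ| < s` for all `t < T_z`). This is Rohde–Schramm's
`T := inf{t ≥ 0 : |wₜ| = s₀}` (p. 905; for the continuous path `w` started at `|w₀| ≤ s₀` the two
infima agree, `abs_cotArg_cotArgExitTime`). [cite: RohdeSchramm2005, Lemma 6.3] -/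
def cotArgExitTime (W : ℝ≥0 → ℝ) (z : ℂ) (s : ℝ) : WithTop ℝ≥0 :=
  sInf ((fun t : ℝ≥0 ↦ (t : WithTop ℝ≥0)) ''
    {t | (t : WithTop ℝ≥0) < swallowingTime W z ∧ s ≤ |cotArg W z t|})

/-- Unfolding lemma for `centredMap`. [folklore] -/
theorem centredMap_apply (W : ℝ≥0 → ℝ) (t : ℝ≥0) (z : ℂ) : centredMap W t z = map W t z - W t :=
  rfl

/-- Unfolding lemma for `cotArg`. [folklore] -/
theorem cotArg_apply (W : ℝ≥0 → ℝ) (z : ℂ) (t : ℝ≥0) :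
    cotArg W z t = (centredMap W t z).re / (centredMap W t z).im := rfl

/-- Unfolding lemma for `derivRatio`. [folklore] -/
theorem derivRatio_apply (W : ℝ≥0 → ℝ) (z : ℂ) (t : ℝ≥0) :
    derivRatio W z t = z.im * ‖deriv (map W t) z‖ / (map W t z).im := rfl

/-- `Im zₜ = Im gₜ(z)` (the driving function is real). [folklore] -/
@[simp]
theorem im_centredMap (W : ℝ≥0 → ℝ) (t : ℝ≥0) (z : ℂ) : (centredMap W t z).im = (map W t z).im := by
  simp [centredMap]

/-- Along a solution `g` alive at time `t`, `zₜ = g t - W t`. [folklore] -/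
theorem centredMap_eq_of_isSolution (hW : Continuous W) (h : IsSolution W z g T) {t : ℝ≥0}
    (ht : (t : WithTop ℝ≥0) < T) : centredMap W t z = g t - W t := by
  rw [centredMap, map_eq_of_isSolution hW h ht]

/-- At time `0`, `z₀ = z - W 0` (off the driving point). [folklore] -/
theorem centredMap_zero (hW : Continuous W) (hz : z ≠ W 0) : centredMap W 0 z = z - W 0 := by
  rw [centredMap, map_zero_apply hW hz]

/-- For `z ∈ ℍ` and `t < T_z`, `yₜ = Im zₜ > 0`. [folklore] -/
theorem im_centredMap_pos (hW : Continuous W) (hz : 0 < z.im) {t : ℝ≥0}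
    (ht : (t : WithTop ℝ≥0) < swallowingTime W z) : 0 < (centredMap W t z).im := by
  rw [im_centredMap]
  exact mapsTo_map hW t ((mem_domain_iff W t z).2 ⟨hz, ht⟩)

/-- For `z ∈ ℍ` and `t < T_z`, `zₜ ≠ 0`. [folklore] -/
theorem centredMap_ne_zero (hW : Continuous W) (hz : 0 < z.im) {t : ℝ≥0}
    (ht : (t : WithTop ℝ≥0) < swallowingTime W z) : centredMap W t z ≠ 0 := fun h ↦ by
  have := im_centredMap_pos hW hz ht
  rw [h, Complex.zero_im] at this
  exact lt_irrefl _ this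

/-- `|zₜ|² = yₜ² (1 + wₜ²)` (`x² + y² = y² (1 + (x/y)²)`, `yₜ ≠ 0`). [folklore] -/
theorem normSq_centredMap_eq (hW : Continuous W) (hz : 0 < z.im) {t : ℝ≥0}
    (ht : (t : WithTop ℝ≥0) < swallowingTime W z) :
    Complex.normSq (centredMap W t z) = (centredMap W t z).im ^ 2 * (1 + cotArg W z t ^ 2) := by
  have hy : (centredMap W t z).im ≠ 0 := (im_centredMap_pos hW hz ht).ne'
  rw [Complex.normSq_apply, cotArg_apply]
  field_simp
  ring

/-- `Im zₜ ≤ Im z` for `z ∈ ℍ`, `t < T_z` (the imaginary part decreases along the flow).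
[folklore] -/
theorem im_centredMap_le (hW : Continuous W) (hz : 0 < z.im) {t : ℝ≥0}
    (ht : (t : WithTop ℝ≥0) < swallowingTime W z) : (centredMap W t z).im ≤ z.im := by
  rw [im_centredMap]
  exact im_map_le hW hz ht

/-- At time `0` the ratio `ψ₀ = 1` for `z ∈ ℍ` (`g₀ = id` near `z`). [folklore] -/
theorem derivRatio_zero (hW : Continuous W) (hz : 0 < z.im) : derivRatio W z 0 = 1 := by
  have hzW : z ≠ (W 0 : ℂ) := ne_driving_of_im_pos hz 0
  have hne : ∀ᶠ w in 𝓝 z, w ≠ (W 0 : ℂ) := isOpen_ne.mem_nhds hzW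
  have heq : map W 0 =ᶠ[𝓝 z] id := hne.mono fun w hw ↦ map_zero_apply hW hw
  rw [derivRatio_apply, heq.deriv_eq, deriv_id, norm_one, mul_one, map_zero_apply hW hzW,
    div_self hz.ne']

/-- **(6.3) for the ratio**: `ψₜ = exp ∫₀ᵗ 4 yₛ² |zₛ|⁻⁴ ds` for `z ∈ ℍ`, `t < T_z`
(`im_mul_norm_deriv_map_div_im_eq_exp`). [cite: RohdeSchramm2005, eq. (6.3)] -/
theorem derivRatio_eq_exp (hW : Continuous W) (hz : 0 < z.im) {t : ℝ≥0}
    (ht : (t : WithTop ℝ≥0) < swallowingTime W z) :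
    derivRatio W z t = Real.exp (∫ s in (0:ℝ)..t, derivRatioRate W z s) :=
  im_mul_norm_deriv_map_div_im_eq_exp hW hz ht

/-- `1 ≤ ψₜ` for `t < T_z`. [cite: RohdeSchramm2005, Lemma 6.3] -/
theorem one_le_derivRatio (hW : Continuous W) (hz : 0 < z.im) {t : ℝ≥0}
    (ht : (t : WithTop ℝ≥0) < swallowingTime W z) : 1 ≤ derivRatio W z t :=
  one_le_im_mul_norm_deriv_map_div_im hW hz ht

/-- `ψ` is non-decreasing on `[0, T_z)`. [cite: RohdeSchramm2005, eq. (6.3)] -/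
theorem derivRatio_mono (hW : Continuous W) (hz : 0 < z.im) {s t : ℝ≥0} (hst : s ≤ t)
    (ht : (t : WithTop ℝ≥0) < swallowingTime W z) : derivRatio W z s ≤ derivRatio W z t :=
  im_mul_norm_deriv_map_div_im_mono hW hz hst ht

/-! ### Continuity of `t ↦ zₜ` and `t ↦ wₜ` on `[0, T_z)` -/

/-- `t ↦ zₜ` is continuous on `[0, T_z)` (it is a solution of the Loewner equation minus the
continuous driving function). [folklore] -/
theorem continuousOn_centredMap (hW : Continuous W) (hz : z ≠ W 0) :
    ContinuousOn (fun t : ℝ≥0 ↦ centredMap W t z)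
      {t | (t : WithTop ℝ≥0) < swallowingTime W z} := by
  obtain ⟨g, hg⟩ := exists_isSolution_swallowingTime_holds hW hz
  have hg' : ContinuousOn (fun t : ℝ≥0 ↦ g t) {t | (t : WithTop ℝ≥0) < swallowingTime W z} := by
    refine hg.continuousOn.comp NNReal.continuous_coe.continuousOn fun t ht ↦ ?_
    exact ⟨t.coe_nonneg, toNNReal_coe_lt ht⟩
  refine (hg'.sub (Complex.continuous_ofReal.comp hW).continuousOn).congr fun t ht ↦ ?_
  exact centredMap_eq_of_isSolution hW hg ht

/-- `t ↦ wₜ = xₜ/yₜ` is continuous on `[0, T_z)` for `z ∈ ℍ` (`yₜ > 0` there). [folklore] -/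
theorem continuousOn_cotArg (hW : Continuous W) (hz : 0 < z.im) :
    ContinuousOn (cotArg W z) {t | (t : WithTop ℝ≥0) < swallowingTime W z} := by
  have hc := continuousOn_centredMap hW (ne_driving_of_im_pos hz 0)
  exact (Complex.continuous_re.comp_continuousOn hc).div
    (Complex.continuous_im.comp_continuousOn hc) fun t ht ↦ (im_centredMap_pos hW hz ht).ne'

/-- `t ↦ |wₜ|` is continuous on `[0, T_z)` for `z ∈ ℍ`. [folklore] -/
theorem continuousOn_abs_cotArg (hW : Continuous W) (hz : 0 < z.im) :
    ContinuousOn (fun t ↦ |cotArg W z t|) {t | (t : WithTop ℝ≥0) < swallowingTime W z} :=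
  continuous_abs.comp_continuousOn (continuousOn_cotArg hW hz)

/-! ### The exit time of `|w|` from `[0, s)` -/

section ExitTime

variable (W z)

/-- A time `t < T_z` with `s ≤ |wₜ|` bounds the exit time from above. [folklore] -/
theorem cotArgExitTime_le {s : ℝ} {t : ℝ≥0} (ht : (t : WithTop ℝ≥0) < swallowingTime W z)
    (hs : s ≤ |cotArg W z t|) : cotArgExitTime W z s ≤ t :=
  sInf_le ⟨t, ⟨ht, hs⟩, rfl⟩

/-- Strictly before the exit time (and before `T_z`), `|wₜ| < s`. [folklore] -/
theorem abs_cotArg_lt_of_lt_cotArgExitTime {s : ℝ} {t : ℝ≥0}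
    (ht : (t : WithTop ℝ≥0) < swallowingTime W z) (hT : (t : WithTop ℝ≥0) < cotArgExitTime W z s) :
    |cotArg W z t| < s :=
  not_le.1 fun hs ↦ lt_irrefl _ (hT.trans_le (cotArgExitTime_le W z ht hs))

/-- If the exit time is `⊤`, then `|wₜ| < s` for all `t < T_z`. [folklore] -/
theorem abs_cotArg_lt_of_cotArgExitTime_eq_top {s : ℝ} (h : cotArgExitTime W z s = ⊤) {t : ℝ≥0}
    (ht : (t : WithTop ℝ≥0) < swallowingTime W z) : |cotArg W z t| < s :=
  abs_cotArg_lt_of_lt_cotArgExitTime W z ht (by rw [h]; exact WithTop.coe_lt_top t)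

/-- If `|w₀| ≥ s` (and `0 < T_z`), the exit time is `0`. [folklore] -/
theorem cotArgExitTime_eq_zero {s : ℝ} (h0 : (0 : WithTop ℝ≥0) < swallowingTime W z)
    (hs : s ≤ |cotArg W z 0|) : cotArgExitTime W z s = 0 :=
  le_antisymm (by simpa using cotArgExitTime_le W z (t := 0) (by simpa using h0) hs) bot_le

variable {W z}

/-- **The exit time is attained**: for `z ∈ ℍ` and a finite exit time there is `t₀ < T_z` with
`cotArgExitTime W z s = t₀` and `s ≤ |w_{t₀}|` (continuity of `w` on `[0, T_z)`; the set of
admissible times below any admissible time is closed). [folklore] -/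
theorem exists_cotArgExitTime_eq_coe (hW : Continuous W) (hz : 0 < z.im) {s : ℝ}
    (hT : cotArgExitTime W z s ≠ ⊤) :
    ∃ t₀ : ℝ≥0, cotArgExitTime W z s = t₀ ∧ (t₀ : WithTop ℝ≥0) < swallowingTime W z ∧
      s ≤ |cotArg W z t₀| := by
  set S : Set ℝ≥0 := {t | (t : WithTop ℝ≥0) < swallowingTime W z ∧ s ≤ |cotArg W z t|} with hSdef
  have hne : S.Nonempty := by
    by_contra hemp
    rw [not_nonempty_iff_eq_empty] at hemp
    apply hT
    rw [cotArgExitTime, ← hSdef, hemp, image_empty, sInf_empty]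
  obtain ⟨t₁, ht₁⟩ := hne
  -- the admissible times in `[0, t₁]` form a closed nonempty set
  set S' : Set ℝ≥0 := {t | t ∈ Iic t₁ ∧ s ≤ |cotArg W z t|} with hS'def
  have hS'S : S' ⊆ S := fun t ht ↦
    ⟨lt_of_le_of_lt (WithTop.coe_le_coe.2 (mem_Iic.1 ht.1)) ht₁.1, ht.2⟩
  have ht₁S' : t₁ ∈ S' := ⟨mem_Iic.2 le_rfl, ht₁.2⟩
  have hcl : IsClosed S' := by
    have hsub : Iic t₁ ⊆ {t : ℝ≥0 | (t : WithTop ℝ≥0) < swallowingTime W z} := fun t ht ↦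
      lt_of_le_of_lt (WithTop.coe_le_coe.2 (mem_Iic.1 ht)) ht₁.1
    have hc : ContinuousOn (fun t ↦ |cotArg W z t|) (Iic t₁) :=
      (continuousOn_abs_cotArg hW hz).mono hsub
    have : S' = Iic t₁ ∩ (fun t ↦ |cotArg W z t|) ⁻¹' Ici s := by
      ext t
      simp [hS'def]
    rw [this]
    exact hc.preimage_isClosed_of_isClosed isClosed_Iic isClosed_Ici
  have hmem : sInf S' ∈ S' := hcl.csInf_mem ⟨t₁, ht₁S'⟩ (OrderBot.bddBelow _)
  -- `inf S = inf S'`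
  have hinf : sInf S = sInf S' := by
    refine le_antisymm (csInf_le_csInf (OrderBot.bddBelow _) ⟨t₁, ht₁S'⟩ hS'S) ?_
    refine le_csInf ⟨t₁, ht₁⟩ fun u hu ↦ ?_
    rcases le_or_gt u t₁ with hut | hut
    · exact csInf_le (OrderBot.bddBelow _) ⟨mem_Iic.2 hut, hu.2⟩
    · exact (csInf_le (OrderBot.bddBelow _) ht₁S').trans hut.le
  refine ⟨sInf S', ?_, (hS'S hmem).1, hmem.2⟩
  rw [cotArgExitTime, ← hSdef, ← WithTop.coe_sInf' ⟨t₁, ht₁⟩ (OrderBot.bddBelow _), hinf]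

/-- A finite exit time is a genuine time before `T_z` at which `s ≤ |w|`. [folklore] -/
theorem lt_swallowingTime_of_cotArgExitTime_eq_coe (hW : Continuous W) (hz : 0 < z.im) {s : ℝ}
    {t₀ : ℝ≥0} (hT : cotArgExitTime W z s = t₀) :
    (t₀ : WithTop ℝ≥0) < swallowingTime W z ∧ s ≤ |cotArg W z t₀| := by
  obtain ⟨t₁, ht₁, hlt, hs⟩ := exists_cotArgExitTime_eq_coe hW hz (s := s)
    (by rw [hT]; exact WithTop.coe_ne_top)
  rw [hT] at ht₁
  have : t₀ = t₁ := WithTop.coe_injective ht₁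
  subst this
  exact ⟨hlt, hs⟩

/-- **`|w_T| = s` at a finite exit time `T`, when `|w₀| < s`** (continuity of `w`: `|wₜ| < s`
before `T`, `s ≤ |w_T|` at `T > 0`). This identifies `cotArgExitTime` with Rohde–Schramm's
`T = inf{t : |wₜ| = s₀}` (p. 905). [cite: RohdeSchramm2005, Lemma 6.3] -/
theorem abs_cotArg_cotArgExitTime (hW : Continuous W) (hz : 0 < z.im) {s : ℝ}
    (h0 : |cotArg W z 0| < s) {t₀ : ℝ≥0} (hT : cotArgExitTime W z s = t₀) :
    |cotArg W z t₀| = s := by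
  obtain ⟨hlt, hs⟩ := lt_swallowingTime_of_cotArgExitTime_eq_coe hW hz hT
  refine le_antisymm ?_ hs
  -- `t₀ > 0`, and `|w_t| < s` for `t < t₀`; pass to the limit `t ↑ t₀`
  have ht₀ : t₀ ≠ 0 := by
    rintro rfl
    exact not_lt.2 hs h0
  have ht₀' : 0 < t₀ := pos_iff_ne_zero.2 ht₀
  have hsub : Iic t₀ ⊆ {t : ℝ≥0 | (t : WithTop ℝ≥0) < swallowingTime W z} := fun t ht ↦
    lt_of_le_of_lt (WithTop.coe_le_coe.2 (mem_Iic.1 ht)) hlt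
  have hcont : ContinuousWithinAt (fun t ↦ |cotArg W z t|) (Iio t₀) t₀ :=
    (((continuousOn_abs_cotArg hW hz).mono hsub).continuousWithinAt (mem_Iic.2 le_rfl)).mono
      Iio_subset_Iic_self
  haveI : (𝓝[Iio t₀] t₀).NeBot := nhdsLT_neBot_of_exists_lt ⟨0, ht₀'⟩
  refine le_of_tendsto hcont.tendsto ?_
  filter_upwards [self_mem_nhdsWithin] with t ht
  exact (abs_cotArg_lt_of_lt_cotArgExitTime W z
    (lt_trans (WithTop.coe_lt_coe.2 (mem_Iio.1 ht)) hlt)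
    (by rw [hT]; exact WithTop.coe_lt_coe.2 (mem_Iio.1 ht))).le

/-- Up to a finite exit time (`|w₀| ≤ s`... in fact always before it, and at it by continuity when
`|w₀| < s`), `|wₜ| ≤ s`: the form used for bounding `Ĝ(zₜ)` on `[0, T]`. [folklore] -/
theorem abs_cotArg_le_of_le_cotArgExitTime (hW : Continuous W) (hz : 0 < z.im) {s : ℝ}
    (h0 : |cotArg W z 0| < s) {t : ℝ≥0} (ht : (t : WithTop ℝ≥0) < swallowingTime W z)
    (hT : (t : WithTop ℝ≥0) ≤ cotArgExitTime W z s) : |cotArg W z t| ≤ s := by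
  rcases hT.lt_or_eq with hlt | heq
  · exact (abs_cotArg_lt_of_lt_cotArgExitTime W z ht hlt).le
  · exact (abs_cotArg_cotArgExitTime hW hz h0 heq.symm).le

end ExitTime

/-! ### At a finite swallowing time the imaginary part tends to `0` -/

/-- **`yₜ → 0` as `t ↑ T_z < ∞`**: if the swallowing time of `z ∈ ℍ` is finite, then for every
`ε > 0`, `Im zₜ < ε` for all `t < T_z` close to `T_z`. (The maximal solution comes `ε`-close to
the driving function before dying, `IsSolution.exists_norm_sub_lt`, `Im zₜ ≤ |zₜ|`, and `Im zₜ`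
is non-increasing.) Rohde–Schramm (2005), proof of Lemma 6.3: "`τ(ẑ)` is a.s. the time at which
`u = log yₜ` hits `-∞`" (p. 904) — here the deterministic half: at a finite `τ`, `u ↓ -∞`.
[cite: RohdeSchramm2005, Lemma 6.3] -/
theorem exists_forall_im_centredMap_lt (hW : Continuous W) (hz : 0 < z.im) {b : ℝ≥0}
    (hτ : swallowingTime W z = b) {ε : ℝ} (hε : 0 < ε) :
    ∃ t₀ : ℝ≥0, (t₀ : WithTop ℝ≥0) < swallowingTime W z ∧
      ∀ t : ℝ≥0, t₀ ≤ t → (t : WithTop ℝ≥0) < swallowingTime W z → (centredMap W t z).im < ε := by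
  have hzW : z ≠ W 0 := ne_driving_of_im_pos hz 0
  have hb : 0 < b := by
    have := swallowingTime_pos_holds hW hzW
    rw [hτ] at this
    exact_mod_cast this
  obtain ⟨g, hg⟩ := exists_isSolution_swallowingTime_holds hW hzW
  have hgb : IsSolution W z g b := hτ ▸ hg
  obtain ⟨u, hu0, hub, hu⟩ := hgb.exists_norm_sub_lt hW hb hτ hε
  have huτ : ((u.toNNReal : ℝ≥0) : WithTop ℝ≥0) < swallowingTime W z := by
    rw [hτ, WithTop.coe_lt_coe]
    exact (Real.toNNReal_lt_iff_lt_coe hu0).2 hub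
  refine ⟨u.toNNReal, huτ, fun t hut ht ↦ ?_⟩
  have htu : u ≤ (t : ℝ) := by
    have := NNReal.coe_le_coe.2 hut
    rwa [Real.coe_toNNReal _ hu0] at this
  have hmem_u : u ∈ {s : ℝ | 0 ≤ s ∧ (s.toNNReal : WithTop ℝ≥0) < swallowingTime W z} := ⟨hu0, huτ⟩
  have hmem_t : (t : ℝ) ∈ {s : ℝ | 0 ≤ s ∧ (s.toNNReal : WithTop ℝ≥0) < swallowingTime W z} :=
    ⟨t.coe_nonneg, toNNReal_coe_lt ht⟩
  have hanti := hg.im_antitoneOn hW hz hmem_u hmem_t htu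
  calc (centredMap W t z).im = (g t).im := by
        rw [centredMap_eq_of_isSolution hW hg ht, Complex.sub_im, Complex.ofReal_im, sub_zero]
    _ ≤ (g u).im := hanti
    _ = (g u - W u.toNNReal).im := by rw [Complex.sub_im, Complex.ofReal_im, sub_zero]
    _ ≤ |(g u - W u.toNNReal).im| := le_abs_self _
    _ ≤ ‖g u - W u.toNNReal‖ := Complex.abs_im_le_norm _
    _ < ε := hu

/-! ### Divergence of `ψ` when `|w|` stays bounded -/

/-- `|Z|² = (Im Z)² (1 + (Re Z / Im Z)²)` for `Im Z ≠ 0`. [folklore] -/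
theorem normSq_eq_im_sq_mul {Z : ℂ} (hZ : Z.im ≠ 0) :
    Complex.normSq Z = Z.im ^ 2 * (1 + (Z.re / Z.im) ^ 2) := by
  rw [Complex.normSq_apply]
  field_simp
  ring

/-- The rate `4 y²/|Z|⁴ = 4 / (y² (1 + w²)²)`, `w = x/y`, `y = Im Z ≠ 0`. [folklore] -/
theorem rate_eq_of_im_ne_zero {Z : ℂ} (hZ : Z.im ≠ 0) :
    4 * Z.im ^ 2 / ‖Z‖ ^ 4 = 4 / (Z.im ^ 2 * (1 + (Z.re / Z.im) ^ 2) ^ 2) := by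
  have h4 : ‖Z‖ ^ 4 = (Complex.normSq Z) ^ 2 := by
    rw [Complex.normSq_eq_norm_sq]; ring
  rw [h4, normSq_eq_im_sq_mul hZ]
  have h1 : (0 : ℝ) < 1 + (Z.re / Z.im) ^ 2 := by positivity
  field_simp

/-- **Lower bound for the rate when `|w| ≤ s`**: `4 y²/|Z|⁴ ≥ 4 / (y² (1 + s²)²)`. [folklore] -/
theorem div_le_rate_of_abs_le {Z : ℂ} (hZ : 0 < Z.im) {s : ℝ} (hs : |Z.re / Z.im| ≤ s) :
    4 / (Z.im ^ 2 * (1 + s ^ 2) ^ 2) ≤ 4 * Z.im ^ 2 / ‖Z‖ ^ 4 := by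
  rw [rate_eq_of_im_ne_zero hZ.ne']
  have hw2 : (Z.re / Z.im) ^ 2 ≤ s ^ 2 := by
    have h0 : 0 ≤ s := (abs_nonneg _).trans hs
    calc (Z.re / Z.im) ^ 2 = |Z.re / Z.im| ^ 2 := (sq_abs _).symm
      _ ≤ s ^ 2 := pow_le_pow_left₀ (abs_nonneg _) hs 2
  have h1 : (0 : ℝ) < 1 + (Z.re / Z.im) ^ 2 := by positivity
  have hy : 0 < Z.im ^ 2 := by positivity
  gcongr

/-- **Second lower bound when `|w| ≤ s`**: `4 y²/|Z|⁴ ≥ (2/|Z|²) · (2/(1 + s²))` (the form matching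
(3.4), `∂ₜ log yₜ = -2/|zₜ|²`). [folklore] -/
theorem mul_le_rate_of_abs_le {Z : ℂ} (hZ : 0 < Z.im) {s : ℝ} (hs : |Z.re / Z.im| ≤ s) :
    2 / Complex.normSq Z * (2 / (1 + s ^ 2)) ≤ 4 * Z.im ^ 2 / ‖Z‖ ^ 4 := by
  rw [rate_eq_of_im_ne_zero hZ.ne', normSq_eq_im_sq_mul hZ.ne']
  have hw2 : (Z.re / Z.im) ^ 2 ≤ s ^ 2 := by
    calc (Z.re / Z.im) ^ 2 = |Z.re / Z.im| ^ 2 := (sq_abs _).symm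
      _ ≤ s ^ 2 := pow_le_pow_left₀ (abs_nonneg _) hs 2
  have h1 : (0 : ℝ) < 1 + (Z.re / Z.im) ^ 2 := by positivity
  have hy : 0 < Z.im ^ 2 := by positivity
  rw [div_mul_div_comm, show (2 : ℝ) * 2 = 4 by norm_num, pow_two (1 + (Z.re / Z.im) ^ 2),
    ← mul_assoc]
  gcongr

/-- Along `[0, t] ⊆ [0, T_z)`, the rate at real time `u` is `4 yᵤ² / |zᵤ|⁴` with `zᵤ = centredMap`.
[folklore] -/
theorem derivRatioRate_eq_centredMap (W : ℝ≥0 → ℝ) (z : ℂ) (u : ℝ) :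
    derivRatioRate W z u =
      4 * (centredMap W u.toNNReal z).im ^ 2 / ‖centredMap W u.toNNReal z‖ ^ 4 := rfl

/-- **Case `T_z = ∞` of the divergence**: if `|wᵤ| ≤ s` for `u ∈ [0, t]`, `t < T_z`, then
`∫₀ᵗ 4y²/|z|⁴ ≥ 4 t / ((Im z)² (1 + s²)²)` (`yᵤ ≤ Im z`). [cite: RohdeSchramm2005, eq. (6.3)] -/
theorem mul_le_integral_derivRatioRate (hW : Continuous W) (hz : 0 < z.im) {s : ℝ} {t : ℝ≥0}
    (ht : (t : WithTop ℝ≥0) < swallowingTime W z)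
    (hs : ∀ u : ℝ≥0, u ≤ t → |cotArg W z u| ≤ s) :
    4 / (z.im ^ 2 * (1 + s ^ 2) ^ 2) * t ≤ ∫ u in (0:ℝ)..t, derivRatioRate W z u := by
  have hc : ∫ u in (0:ℝ)..t, (4 / (z.im ^ 2 * (1 + s ^ 2) ^ 2) : ℝ) =
      4 / (z.im ^ 2 * (1 + s ^ 2) ^ 2) * t := by
    rw [intervalIntegral.integral_const, smul_eq_mul, sub_zero, mul_comm]
  rw [← hc]
  refine intervalIntegral.integral_mono_on t.coe_nonneg intervalIntegrable_const
    (intervalIntegrable_derivRatioRate hW ht) fun u hu ↦ ?_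
  have hu0 : 0 ≤ u := hu.1
  have huτ : ((u.toNNReal : ℝ≥0) : WithTop ℝ≥0) < swallowingTime W z :=
    lt_of_le_of_lt (WithTop.coe_le_coe.2 (by
      rw [← NNReal.coe_le_coe, Real.coe_toNNReal _ hu0]; exact hu.2)) ht
  have hule : u.toNNReal ≤ t := by
    rw [← NNReal.coe_le_coe, Real.coe_toNNReal _ hu0]; exact hu.2
  have hy : 0 < (centredMap W u.toNNReal z).im := im_centredMap_pos hW hz huτ
  have hyle : (centredMap W u.toNNReal z).im ≤ z.im := im_centredMap_le hW hz huτ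
  rw [derivRatioRate_eq_centredMap]
  refine le_trans ?_ (div_le_rate_of_abs_le hy (hs _ hule))
  have h1 : (0 : ℝ) < (1 + s ^ 2) ^ 2 := by positivity
  have hy2 : 0 < (centredMap W u.toNNReal z).im ^ 2 := by positivity
  gcongr

/-- **(3.4), logarithmic form**: `∫₀ᵗ 2/|zᵤ|² du = log (Im z) - log (Im zₜ)` for `z ∈ ℍ`,
`t < T_z` (`IsSolution.im_eq_mul_exp`). [cite: RohdeSchramm2005, eq. (3.4)] -/
theorem integral_two_div_normSq_eq_log (hW : Continuous W) (hz : 0 < z.im) {t : ℝ≥0}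
    (ht : (t : WithTop ℝ≥0) < swallowingTime W z) :
    ∫ u in (0:ℝ)..t, 2 / Complex.normSq (centredMap W u.toNNReal z) =
      Real.log z.im - Real.log (centredMap W t z).im := by
  have hzW : z ≠ W 0 := ne_driving_of_im_pos hz 0
  obtain ⟨g, hg⟩ := exists_isSolution_swallowingTime_holds hW hzW
  have htT := toNNReal_coe_lt ht
  have hsub := Icc_subset_timeDomain (T := swallowingTime W z) htT
  have him := hg.im_eq_mul_exp hW t.coe_nonneg htT
  have hyt : 0 < (centredMap W t z).im := im_centredMap_pos hW hz ht
  have hgt : (centredMap W t z).im = (g t).im := by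
    rw [centredMap_eq_of_isSolution hW hg ht, Complex.sub_im, Complex.ofReal_im, sub_zero]
  -- the integrand along the solution
  have hcongr : ∫ u in (0:ℝ)..t, 2 / Complex.normSq (centredMap W u.toNNReal z) =
      -∫ u in (0:ℝ)..t, -2 / Complex.normSq (g u - W u.toNNReal) := by
    rw [← intervalIntegral.integral_neg]
    refine intervalIntegral.integral_congr fun u hu ↦ ?_
    rw [uIcc_of_le t.coe_nonneg] at hu
    have hu' := hsub hu
    rw [centredMap_eq_of_isSolution hW hg hu'.2, Real.coe_toNNReal _ hu.1, neg_div, neg_neg]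
  rw [hcongr]
  have hlog : Real.log (g t).im =
      Real.log z.im + ∫ u in (0:ℝ)..t, -2 / Complex.normSq (g u - W u.toNNReal) := by
    rw [him, Real.log_mul hz.ne' (Real.exp_pos _).ne', Real.log_exp]
  rw [hgt, hlog]
  ring

/-- **Case `T_z < ∞` of the divergence**: if `|wᵤ| ≤ s` for `u ∈ [0, t]`, `t < T_z`, then
`∫₀ᵗ 4y²/|z|⁴ ≥ (2/(1+s²)) (log (Im z) - log (Im zₜ))` (by (3.4) and
`4y²/|z|⁴ ≥ (2/|z|²)(2/(1+s²))`); Rohde–Schramm's second form of (6.3),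
`log Z = ∫ (-2y²/(x²+y²)) d log y`. [cite: RohdeSchramm2005, eq. (6.3)] -/
theorem mul_log_le_integral_derivRatioRate (hW : Continuous W) (hz : 0 < z.im) {s : ℝ} {t : ℝ≥0}
    (ht : (t : WithTop ℝ≥0) < swallowingTime W z)
    (hs : ∀ u : ℝ≥0, u ≤ t → |cotArg W z u| ≤ s) :
    2 / (1 + s ^ 2) * (Real.log z.im - Real.log (centredMap W t z).im) ≤
      ∫ u in (0:ℝ)..t, derivRatioRate W z u := by
  rw [← integral_two_div_normSq_eq_log hW hz ht, ← intervalIntegral.integral_const_mul]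
  have hzW : z ≠ W 0 := ne_driving_of_im_pos hz 0
  have htT := toNNReal_coe_lt ht
  have hsub := Icc_subset_timeDomain (T := swallowingTime W z) htT
  -- integrability of the left integrand: it is continuous on `[0, t]`
  have hcont : ContinuousOn (fun u : ℝ ↦ 2 / Complex.normSq (centredMap W u.toNNReal z)) (Icc 0 t) := by
    have hc : ContinuousOn (fun u : ℝ ↦ centredMap W u.toNNReal z) (Icc 0 t) := by
      refine (continuousOn_centredMap hW hzW).comp continuous_real_toNNReal.continuousOn ?_
      intro u hu
      exact (hsub hu).2
    refine continuousOn_const.div (Complex.continuous_normSq.comp_continuousOn hc) fun u hu ↦ ?_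
    exact (Complex.normSq_pos.2 (centredMap_ne_zero hW hz (hsub hu).2)).ne'
  have hint : IntervalIntegrable (fun u : ℝ ↦ 2 / (1 + s ^ 2) *
      (2 / Complex.normSq (centredMap W u.toNNReal z))) volume 0 t :=
    ((continuousOn_const.mul hcont).mono (by rw [uIcc_of_le t.coe_nonneg])).intervalIntegrable
  refine intervalIntegral.integral_mono_on t.coe_nonneg hint
    (intervalIntegrable_derivRatioRate hW ht) fun u hu ↦ ?_
  have hu0 : 0 ≤ u := hu.1
  have huτ : ((u.toNNReal : ℝ≥0) : WithTop ℝ≥0) < swallowingTime W z := (hsub hu).2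
  have hule : u.toNNReal ≤ t := by
    rw [← NNReal.coe_le_coe, Real.coe_toNNReal _ hu0]; exact hu.2
  have hy : 0 < (centredMap W u.toNNReal z).im := im_centredMap_pos hW hz huτ
  rw [derivRatioRate_eq_centredMap, mul_comm]
  exact mul_le_rate_of_abs_le hy (hs _ hule)

/-- **If `|wₜ| ≤ s` for all `t < T_z`, then `ψₜ → ∞` as `t ↑ T_z`** (through the time interval
`{t | ↑t < T_z}`; `z ∈ ℍ`, continuous driving function). By (6.3) it suffices that
`∫₀ᵗ 4y²/|z|⁴ → ∞`: if `T_z = ∞` use `∫₀ᵗ ≥ 4t/((Im z)²(1+s²)²)`; if `T_z < ∞` use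
`∫₀ᵗ ≥ (2/(1+s²))(log Im z - log Im zₜ)` and `Im zₜ → 0`. This is "if `|Re gₜ(i)/Im gₜ(i)|` never
hits `|w₀|`, then we have `Z(i) = ∞`, by (6.3)" (Rohde–Schramm (2005), p. 905).
[cite: RohdeSchramm2005, Lemma 6.3] -/
theorem tendsto_derivRatio_atTop_of_abs_cotArg_le (hW : Continuous W) (hz : 0 < z.im) {s : ℝ}
    (hs : ∀ t : ℝ≥0, (t : WithTop ℝ≥0) < swallowingTime W z → |cotArg W z t| ≤ s) :
    Tendsto (fun t : {t : ℝ≥0 // (t : WithTop ℝ≥0) < swallowingTime W z} ↦ derivRatio W z t)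
      atTop atTop := by
  have hzW : z ≠ W 0 := ne_driving_of_im_pos hz 0
  have h0 : ((0 : ℝ≥0) : WithTop ℝ≥0) < swallowingTime W z := swallowingTime_pos_holds hW hzW
  haveI : Nonempty {t : ℝ≥0 // (t : WithTop ℝ≥0) < swallowingTime W z} := ⟨⟨0, h0⟩⟩
  have heq : (fun t : {t : ℝ≥0 // (t : WithTop ℝ≥0) < swallowingTime W z} ↦ derivRatio W z t) =
      fun t : {t : ℝ≥0 // (t : WithTop ℝ≥0) < swallowingTime W z} ↦
        Real.exp (∫ u in (0:ℝ)..((t : ℝ≥0) : ℝ), derivRatioRate W z u) :=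
    funext fun t ↦ derivRatio_eq_exp hW hz t.2
  rw [heq, Real.tendsto_exp_comp_atTop]
  rw [tendsto_atTop_atTop]
  intro K
  rcases eq_or_ne (swallowingTime W z) ⊤ with hτ | hτ
  · -- `T_z = ∞`: linear growth of the integral
    set c : ℝ := 4 / (z.im ^ 2 * (1 + s ^ 2) ^ 2) with hc
    have hcpos : 0 < c := by rw [hc]; positivity
    refine ⟨⟨(K / c).toNNReal, by rw [hτ]; exact WithTop.coe_lt_top _⟩, fun t ht ↦ ?_⟩
    have ht' : K / c ≤ ((t : ℝ≥0) : ℝ) := by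
      have := NNReal.coe_le_coe.2 (Subtype.coe_le_coe.2 ht)
      exact (Real.le_coe_toNNReal _).trans this
    calc K = c * (K / c) := by field_simp
      _ ≤ c * ((t : ℝ≥0) : ℝ) := by gcongr
      _ ≤ ∫ u in (0:ℝ)..(t : ℝ≥0), derivRatioRate W z u :=
        mul_le_integral_derivRatioRate hW hz t.2 fun u hu ↦
          hs u (lt_of_le_of_lt (WithTop.coe_le_coe.2 hu) t.2)
  · -- `T_z = b < ∞`: `Im zₜ → 0` and the logarithmic bound
    obtain ⟨b, hb⟩ := WithTop.ne_top_iff_exists.1 hτ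
    set ε : ℝ := z.im * Real.exp (-(K * (1 + s ^ 2) / 2)) with hεdef
    have hε : 0 < ε := by rw [hεdef]; positivity
    obtain ⟨t₀, ht₀, hlt⟩ := exists_forall_im_centredMap_lt hW hz hb.symm hε
    refine ⟨⟨t₀, ht₀⟩, fun t ht ↦ ?_⟩
    have hyt : 0 < (centredMap W (t : ℝ≥0) z).im := im_centredMap_pos hW hz t.2
    have hy : (centredMap W (t : ℝ≥0) z).im < ε := hlt t (Subtype.coe_le_coe.2 ht) t.2
    have h1 : 0 < 1 + s ^ 2 := by positivity
    have hlog : K * (1 + s ^ 2) / 2 ≤ Real.log z.im - Real.log (centredMap W (t : ℝ≥0) z).im := by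
      have h2 : Real.log (centredMap W (t : ℝ≥0) z).im < Real.log ε := Real.log_lt_log hyt hy
      have h3 : Real.log ε = Real.log z.im - K * (1 + s ^ 2) / 2 := by
        rw [hεdef, Real.log_mul hz.ne' (Real.exp_pos _).ne', Real.log_exp]; ring
      linarith
    calc K = 2 / (1 + s ^ 2) * (K * (1 + s ^ 2) / 2) := by field_simp
      _ ≤ 2 / (1 + s ^ 2) * (Real.log z.im - Real.log (centredMap W (t : ℝ≥0) z).im) := by
        gcongr
      _ ≤ ∫ u in (0:ℝ)..(t : ℝ≥0), derivRatioRate W z u :=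
        mul_log_le_integral_derivRatioRate hW hz t.2 fun u hu ↦
          hs u (lt_of_le_of_lt (WithTop.coe_le_coe.2 hu) t.2)

end Loewner

end Literature.Probability.RandomPlanarGeometry

end
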